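import Summits.BirchSwinnertonDyer.BirchSwinnertonDyer.Theorems.GenusKolyvaginAtTwoPowDvdShaCardAtTwoRTAuxiliaryClassAllPlacesCount
import Summits.BirchSwinnertonDyer.BirchSwinnertonDyer.Theorems.GenusKolyvaginAtTwoPowDvdShaCardAtTwoRTLagrangianReduction
import Summits.BirchSwinnertonDyer.BirchSwinnertonDyer.Theorems.SchneiderFreeAdditiveX3PoitouTateSelmerComplementCanonical
import Summits.BirchSwinnertonDyer.BirchSwinnertonDyer.Theorems.SchneiderFreeAdditiveX3PoitouTateReciprocitySumHolds
import HarnessLib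

/-!
# Route `GenusKolyvaginAtTwo`, LINES 18/19 (L_T stmt-BirchSwinnertonDyer-23242, L⁺_T stmt-23379), step (b) input I5, DEEP form at
# ANY place of ANY number field: McCallum's Prop. 2.1 with a prescribed ORDER at the free place (real places allowed, e.g. `K = ℚ`)

Width seat `bsd-line-gk2-p4` g16 (cell `bsd-f1-sign2`), `--supports stmt-BirchSwinnertonDyer-23242` (helper; closes nothing).
THEOREMS ONLY: no definition, no named fact, no `sorry`; standard axioms.  BSD is NOT proved by any of this.

WHY.  The level-gap readings of McCallum's printed proof of Prop. 5.2 (LEAD gk2-p1 g15 02:25Z; gk2-p2 g16 (F1); gk2-p3 g19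
`Lines/plus-descent-step-b-levels.md`) show that the swap step at depth `M_r ≥ 1` needs a DEEP auxiliary class (local order
`≥ 2^{M_r+2}` at the free Kolyvagin prime), not merely a non-zero one.  gk2-p3 g19 landed the deep form over a TOTALLY COMPLEX `K`
(`exists_mem_kummerOutside_addOrderOf_dvd_sq`, p691198) by Lagrangian reduction (`…RTLagrangianReduction`, p690446) of this seat's
maximal-isotropic `G = loc_T(H¹_{𝓛, ⊤ on T})`.  This file is the same deep form for ANY number field with `S`, `w` places of ANY kind
(finite / real / complex) — the `ℚ`-level currency of LINE 18 (`K = ℚ` has a real place) — read through this seat's all-places count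
`annLeft_map_kummerOutside_eq_places` (p692325), plus its UNCONDITIONAL instance for THE canonical Poitou–Tate family.

WHAT (namespace `…Theorems.GenusExact.AuxiliaryClass`):
* `invWeilPairing_flip_bijective_place` — the right adjoint of `inv_v(· ∪ₑ ·)` is bijective at every place (`IsPerfect` at finite
  places, `inv` injective at real places, complex places trivial).
* **`exists_mem_kummerOutside_addOrderOf_dvd_sq_places`** — displayed inputs (`IsPerfect`, `SumLocalTermEqZero`, `SelmerComplement`,
  Tate's count, `inv` injective at the real places), `S : Finset (Place K)`, `w ∉ S` any place, `H_v` LAGRANGIAN for `inv_v(· ∪ₑ ·)` on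
  `S`: for every `x₀ ∈ H¹(K_w, E[p^k])` there is `c ∈ kummerOutside W (p^k) (insert w S)` with `loc_v c ∈ H_v` (`v ∈ S`) and
  **`ord x₀ ∣ ord(loc_w c)²`**.
* `exists_mem_kummerOutside_addOrderOf_eq_pow_places` — `ord x₀ = p^M ⟹ ord(loc_w c) = p^j` with `M ≤ 2j`.
* **`exists_mem_kummerOutside_addOrderOf_dvd_sq_canonical`** / `…_eq_pow_canonical` — UNCONDITIONAL for EVERY number field: the
  same with `inv :=` THE canonical family `LocalInvariants.canonical K (p^k)` (`canonical_isPerfect`, `sumLocalTermEqZero_canonical`,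
  `selmerComplement_canonical_holds`, `archimedeanInvariantMap_injective_of_isReal`; Tate's count `localEulerPoincareCharacteristic_holds`),
  `k ≥ 1`, the Weil datum displayed (the Lagrangian hypothesis is stated for it).

References: [McCallumLMS1991] §2 Prop. 2.1, §5 proof of Prop. 5.2 and (16)–(17); [MilneADT2006] Ch. I Cor. 2.3, Thm. 2.8, Thm. 2.13,
Thm. 4.10; gk2-p3 g19 `…RTLagrangianReduction` / `…RTAuxiliaryClassDeep`.
-/

set_option autoImplicit false
-- the Theorems namespace of this sub repeats the summit name by design (D-0017 nested layout)
set_option linter.dupNamespace false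

noncomputable section

open scoped Classical

open CategoryTheory Field NumberField IsDedekindDomain Function
open Literature.NumberTheory.EllipticCurves
open Literature.NumberTheory.GaloisRepresentations
open Literature.NumberTheory.GaloisCohomology
open Summit.BirchSwinnertonDyer.Rank1Residual.X11b.KummerPT
open Summit.BirchSwinnertonDyer.Rank1Residual.X11b.FiniteDuality
open Summit.BirchSwinnertonDyer.Rank1Residual.X11b.Relaxation
open Summit.BirchSwinnertonDyer.Rank1Residual.X11b.LocBridge Summit.BirchSwinnertonDyer.Rank1Residual.X11b.Levels
open Summit.BirchSwinnertonDyer.Rank1Residual.X11b.AcSelmer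
open Summit.BirchSwinnertonDyer.BirchSwinnertonDyer.Theorems.GenusExact.LagrangianReduction
open scoped ContRepresentation

namespace Summit.BirchSwinnertonDyer.BirchSwinnertonDyer.Theorems.GenusExact.AuxiliaryClass

open Summit.BirchSwinnertonDyer.BirchSwinnertonDyer.Theorems.GenusKolyKramer (finite_galoisCohomology_toLocal)

/-! ## §1 The right adjoint at every place -/

section Local

variable {K : Type} [Field K] [NumberField K] (W : WeierstrassCurve K) [W.IsElliptic]
variable (n : ℕ) [NeZero n]
variable (e : W.geomTorsion n → W.geomTorsion n → AlgebraicClosure K)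
  (hμ : ∀ S T, e S T ^ n = 1)
  (hadd₁ : ∀ S₁ S₂ T, e (S₁ + S₂) T = e S₁ T * e S₂ T)
  (hadd₂ : ∀ S T₁ T₂, e S (T₁ + T₂) = e S T₁ * e S T₂)
  (hgal : ∀ (σ : absoluteGaloisGroup K) (S T : W.geomTorsion n), σ • e S T = e (σ • S) (σ • T))
  (halt : ∀ T, e T T = 1) (hnondeg : ∀ T, (∀ S, e S T = 1) → T = 0)
  (inv : LocalInvariants K n)

include hnondeg halt in
/-- **The right adjoint of `inv_v(· ∪ₑ ·)` is bijective at every place** (`IsPerfect` at the finite places, `inv` injective at the real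
places, complex places trivial since `H¹ = 0`). [cite: MilneADT2006, Ch. I, Cor. 2.3 and Thm. 2.13] -/
theorem invWeilPairing_flip_bijective_place (hperf : inv.IsPerfect)
    (hreal : ∀ w : InfinitePlace K, w.IsReal → Injective (inv (Sum.inl w))) (v : Place K) :
    Bijective (invWeilPairing W n e hμ hadd₁ hadd₂ hgal inv v).flip := by
  cases v with
  | inl w =>
    by_cases hw : w.IsComplex
    · haveI := subsingleton_galoisCohomology_toLocal_inl_of_isComplex (W.torsionGaloisModule (n : ℤ)) hw
      refine ⟨fun x y _ ↦ Subsingleton.elim x y, fun f ↦ ⟨0, ?_⟩⟩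
      ext y
      rw [Subsingleton.elim y 0, map_zero, map_zero]
    · exact invWeilPairing_flip_bijective_inl W n e hμ hadd₁ hadd₂ hgal halt hnondeg inv w
        (hreal w (InfinitePlace.not_isComplex_iff_isReal.mp hw))
  | inr v => exact invWeilPairing_flip_bijective W n e hμ hadd₁ hadd₂ hgal hnondeg inv v (hperf v).1.1

end Local

/-! ## §2 The deep auxiliary class over any finite set of places -/

section Deep

variable {K : Type} [Field K] [NumberField K] (W : WeierstrassCurve K) [W.IsElliptic]
variable (p k : ℕ) [Fact p.Prime] [Finite (W.geomTorsion ((p ^ k : ℕ) : ℤ))]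
variable (e : W.geomTorsion ((p ^ k : ℕ) : ℤ) → W.geomTorsion ((p ^ k : ℕ) : ℤ) → AlgebraicClosure K)
  (hμ : ∀ S T, e S T ^ (p ^ k) = 1)
  (hadd₁ : ∀ S₁ S₂ T, e (S₁ + S₂) T = e S₁ T * e S₂ T)
  (hadd₂ : ∀ S T₁ T₂, e S (T₁ + T₂) = e S T₁ * e S T₂)
  (hgal : ∀ (σ : absoluteGaloisGroup K) (S T : W.geomTorsion ((p ^ k : ℕ) : ℤ)),
    σ • e S T = e (σ • S) (σ • T))
  (halt : ∀ T, e T T = 1) (hnondeg : ∀ T, (∀ S, e S T = 1) → T = 0)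

include halt hnondeg in
/-- **McCallum's Prop. 2.1, DEEP form, `S` and `w` ANY places of ANY number field.** Displayed inputs (`IsPerfect`,
`SumLocalTermEqZero`, `SelmerComplement`, Tate's count at the finite places, `inv` injective at the real places); the local conditions
`H_v` (`v ∈ S`) LAGRANGIAN for `inv_v(· ∪ₑ ·)`.  Then for every `x₀ ∈ H¹(K_w, E[p^k])` there is a class `c`, Kummer off `S ∪ {w}`,
with `loc_v c ∈ H_v` on `S` and **`ord x₀ ∣ ord(loc_w c)²`**.  Proof: gk2-p3's Lagrangian reduction `exists_mem_addOrderOf_dvd_sq_eval`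
applied to the maximal isotropic `G = loc(H¹_{𝓛, ⊤ on S ∪ {w}})` (`annLeft_map_kummerOutside_eq_places`).
[cite: McCallumLMS1991, §2 Prop. 2.1 and §5 proof of Prop. 5.2] [cite: MilneADT2006, Ch. I, Thm. 4.10] -/
theorem exists_mem_kummerOutside_addOrderOf_dvd_sq_places
    {inv : LocalInvariants K (p ^ k)} (hperf : inv.IsPerfect) (hsum : inv.SumLocalTermEqZero)
    (hcompl : inv.SelmerComplement)
    (hEuler : ∀ v : HeightOneSpectrum (𝓞 K),
      Nat.card (galoisCohomology ((W.torsionGaloisModule ((p ^ k : ℕ) : ℤ)).toLocal (Sum.inr v)) 1) =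
        (Nat.card (nsmulAddMonoidHom (p ^ k) :
            (W.baseChange (v.adicCompletion K)).toAffine.Point →+ _).ker *
          Nat.card (v.adicCompletionIntegers K ⧸
            Ideal.span {((p ^ k : ℕ) : v.adicCompletionIntegers K)})) ^ 2)
    (hreal : ∀ w : InfinitePlace K, w.IsReal → Injective (inv (Sum.inl w)))
    (S : Finset (Place K)) (w : Place K) (hwS : w ∉ S)
    (H : ∀ v : Place K, AddSubgroup (galoisCohomology ((W.torsionGaloisModule ((p ^ k : ℕ) : ℤ)).toLocal v) 1))
    (hH : ∀ v ∈ S, annLeft (invWeilPairing W (p ^ k) e hμ hadd₁ hadd₂ hgal inv v) (H v) = H v)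
    (x₀ : galoisCohomology ((W.torsionGaloisModule ((p ^ k : ℕ) : ℤ)).toLocal w) 1) :
    ∃ c ∈ kummerOutside W (p ^ k) (insert w S),
      (∀ v ∈ S, galoisCohomology.localization (W.torsionGaloisModule ((p ^ k : ℕ) : ℤ)) v 1 c ∈ H v) ∧
      addOrderOf x₀ ∣ addOrderOf (galoisCohomology.localization (W.torsionGaloisModule ((p ^ k : ℕ) : ℤ)) w 1 c) ^ 2 := by
  classical
  obtain ⟨loc, hloc⟩ : ∃ loc : galoisCohomology (W.torsionGaloisModule ((p ^ k : ℕ) : ℤ)) 1 →+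
      (∀ u : ↥(insert w S), galoisCohomology ((W.torsionGaloisModule ((p ^ k : ℕ) : ℤ)).toLocal (u : Place K)) 1),
      ∀ c u, loc c u = galoisCohomology.localization (W.torsionGaloisModule ((p ^ k : ℕ) : ℤ)) (u : Place K) 1 c :=
    ⟨AddMonoidHom.pi fun u ↦ galoisCohomology.localization (W.torsionGaloisModule ((p ^ k : ℕ) : ℤ)) (u : Place K) 1,
      fun c u ↦ rfl⟩
  haveI hfin : ∀ u : Place K, Finite (galoisCohomology ((W.torsionGaloisModule ((p ^ k : ℕ) : ℤ)).toLocal u) 1) :=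
    fun u ↦ finite_galoisCohomology_toLocal W (p ^ k) u
  haveI : ∀ u : ↥(insert w S), Finite (galoisCohomology ((W.torsionGaloisModule ((p ^ k : ℕ) : ℤ)).toLocal
      (u : Place K)) 1) := fun u ↦ hfin u
  have hX : ∀ (u : ↥(insert w S))
      (x : galoisCohomology ((W.torsionGaloisModule ((p ^ k : ℕ) : ℤ)).toLocal (u : Place K)) 1), (p ^ k) • x = 0 :=
    fun u x ↦ nsmul_galoisCohomology_toLocal_eq_zero W (p ^ k) _ x
  have hb : ∀ u : ↥(insert w S), Injective (invWeilPairing W (p ^ k) e hμ hadd₁ hadd₂ hgal inv (u : Place K)) :=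
    fun u ↦ (invWeilPairing_bijective_place W (p ^ k) e hμ hadd₁ hadd₂ hgal halt hnondeg inv hperf hreal (u : Place K)).1
  have hbflip : ∀ u : ↥(insert w S), Injective (invWeilPairing W (p ^ k) e hμ hadd₁ hadd₂ hgal inv (u : Place K)).flip :=
    fun u ↦ (invWeilPairing_flip_bijective_place W (p ^ k) e hμ hadd₁ hadd₂ hgal halt hnondeg inv hperf hreal (u : Place K)).1
  obtain ⟨bP, hbP⟩ := exists_piSum (fun u : ↥(insert w S) ↦ invWeilPairing W (p ^ k) e hμ hadd₁ hadd₂ hgal inv (u : Place K))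
  -- `G` is Lagrangian
  have hG := annLeft_map_kummerOutside_eq_places W p k e hμ hadd₁ hadd₂ hgal halt hnondeg hperf hsum hcompl hEuler hreal
    (insert w S) loc hloc bP hbP
  -- Lagrangian hypotheses at the coordinates other than `w`
  have hH' : ∀ u : ↥(insert w S), u ≠ ⟨w, Finset.mem_insert_self w S⟩ →
      annLeft (invWeilPairing W (p ^ k) e hμ hadd₁ hadd₂ hgal inv (u : Place K)) (H (u : Place K)) = H (u : Place K) := by
    intro u hu
    have huS : (u : Place K) ∈ S := by
      rcases Finset.mem_insert.mp u.2 with h | h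
      · exact absurd (Subtype.ext h) hu
      · exact h
    exact hH _ huS
  obtain ⟨g, hgG, hgH, hdvd⟩ := exists_mem_addOrderOf_dvd_sq_eval
    (X := fun u : ↥(insert w S) ↦ galoisCohomology ((W.torsionGaloisModule ((p ^ k : ℕ) : ℤ)).toLocal (u : Place K)) 1)
    hX (fun u ↦ invWeilPairing W (p ^ k) e hμ hadd₁ hadd₂ hgal inv (u : Place K)) hb hbflip bP hbP
    ⟨w, Finset.mem_insert_self w S⟩ (fun u ↦ H (u : Place K)) hH'
    ((kummerOutside W (p ^ k) (insert w S)).map loc) hG x₀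
  obtain ⟨c, hc, rfl⟩ := hgG
  refine ⟨c, hc, fun v hv ↦ ?_, ?_⟩
  · have hne : (⟨v, Finset.mem_insert_of_mem hv⟩ : ↥(insert w S)) ≠ ⟨w, Finset.mem_insert_self w S⟩ := by
      intro h
      apply hwS
      have hv' : v = w := congrArg Subtype.val h
      rwa [hv'] at hv
    have h := hgH ⟨v, Finset.mem_insert_of_mem hv⟩ hne
    rwa [hloc] at h
  · rwa [hloc] at hdvd

include halt hnondeg in
/-- **Deep Prop. 2.1 at any place, `p`-power form**: `ord x₀ = p^M ⟹ ord(loc_w c) = p^j` with `M ≤ 2j` (so `ord c ≥ p^{⌈M/2⌉}`).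
[cite: McCallumLMS1991, §2 Prop. 2.1 and §5 proof of Prop. 5.2] -/
theorem exists_mem_kummerOutside_addOrderOf_eq_pow_places
    {inv : LocalInvariants K (p ^ k)} (hperf : inv.IsPerfect) (hsum : inv.SumLocalTermEqZero)
    (hcompl : inv.SelmerComplement)
    (hEuler : ∀ v : HeightOneSpectrum (𝓞 K),
      Nat.card (galoisCohomology ((W.torsionGaloisModule ((p ^ k : ℕ) : ℤ)).toLocal (Sum.inr v)) 1) =
        (Nat.card (nsmulAddMonoidHom (p ^ k) :
            (W.baseChange (v.adicCompletion K)).toAffine.Point →+ _).ker *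
          Nat.card (v.adicCompletionIntegers K ⧸
            Ideal.span {((p ^ k : ℕ) : v.adicCompletionIntegers K)})) ^ 2)
    (hreal : ∀ w : InfinitePlace K, w.IsReal → Injective (inv (Sum.inl w)))
    (S : Finset (Place K)) (w : Place K) (hwS : w ∉ S)
    (H : ∀ v : Place K, AddSubgroup (galoisCohomology ((W.torsionGaloisModule ((p ^ k : ℕ) : ℤ)).toLocal v) 1))
    (hH : ∀ v ∈ S, annLeft (invWeilPairing W (p ^ k) e hμ hadd₁ hadd₂ hgal inv v) (H v) = H v)
    {x₀ : galoisCohomology ((W.torsionGaloisModule ((p ^ k : ℕ) : ℤ)).toLocal w) 1} {M : ℕ}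
    (hx₀ : addOrderOf x₀ = p ^ M) :
    ∃ c ∈ kummerOutside W (p ^ k) (insert w S),
      (∀ v ∈ S, galoisCohomology.localization (W.torsionGaloisModule ((p ^ k : ℕ) : ℤ)) v 1 c ∈ H v) ∧
      ∃ j : ℕ, addOrderOf (galoisCohomology.localization (W.torsionGaloisModule ((p ^ k : ℕ) : ℤ)) w 1 c) = p ^ j ∧
        M ≤ 2 * j := by
  obtain ⟨c, hc, hcH, hdvd⟩ := exists_mem_kummerOutside_addOrderOf_dvd_sq_places W p k e hμ hadd₁ hadd₂ hgal halt hnondeg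
    hperf hsum hcompl hEuler hreal S w hwS H hH x₀
  haveI := finite_galoisCohomology_toLocal W (p ^ k) w
  have hr' : addOrderOf (galoisCohomology.localization (W.torsionGaloisModule ((p ^ k : ℕ) : ℤ)) w 1 c) ∣ p ^ k :=
    addOrderOf_dvd_of_nsmul_eq_zero (nsmul_galoisCohomology_toLocal_eq_zero W (p ^ k) _ _)
  obtain ⟨j, -, hrj⟩ := (Nat.dvd_prime_pow (Fact.out : p.Prime)).mp hr'
  refine ⟨c, hc, hcH, j, hrj, ?_⟩
  rw [hx₀, hrj, ← pow_mul] at hdvd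
  have h := (Nat.pow_dvd_pow_iff_le_right (Fact.out : p.Prime).one_lt).mp hdvd
  omega

omit [Finite (W.geomTorsion ((p ^ k : ℕ) : ℤ))] in
include halt hnondeg in
/-- **Deep Prop. 2.1 at any place of ANY number field — UNCONDITIONAL for THE canonical Poitou–Tate family.**  `k ≥ 1`; `S`, `w ∉ S`
any places; `H_v` Lagrangian for `canonical_v(· ∪ₑ ·)` on `S`; then every `x₀ ∈ H¹(K_w, E[p^k])` is dominated as `ord x₀ ∣ ord(loc_w c)²`
by a class `c`, Kummer off `S ∪ {w}`, with `loc_v c ∈ H_v` on `S`.  Inputs, all tree theorems: `LocalInvariants.canonical_isPerfect`,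
`sumLocalTermEqZero_canonical`, `selmerComplement_canonical_holds`, `archimedeanInvariantMap_injective_of_isReal`, Tate's count
`localEulerPoincareCharacteristic_holds`, finiteness of `E[p^k]`.
[cite: McCallumLMS1991, §2 Prop. 2.1 and §5 proof of Prop. 5.2] [cite: MilneADT2006, Ch. I, Thm. 2.8, Thm. 2.13 and Thm. 4.10] -/
theorem exists_mem_kummerOutside_addOrderOf_dvd_sq_canonical (hk : 0 < k)
    (S : Finset (Place K)) (w : Place K) (hwS : w ∉ S)
    (H : ∀ v : Place K, AddSubgroup (galoisCohomology ((W.torsionGaloisModule ((p ^ k : ℕ) : ℤ)).toLocal v) 1))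
    (hH : ∀ v ∈ S, annLeft (haveI : Finite (W.geomTorsion ((p ^ k : ℕ) : ℤ)) := finite_geomTorsion_pow W p k
      invWeilPairing W (p ^ k) e hμ hadd₁ hadd₂ hgal (LocalInvariants.canonical K (p ^ k)) v) (H v) = H v)
    (x₀ : galoisCohomology ((W.torsionGaloisModule ((p ^ k : ℕ) : ℤ)).toLocal w) 1) :
    ∃ c ∈ kummerOutside W (p ^ k) (insert w S),
      (∀ v ∈ S, galoisCohomology.localization (W.torsionGaloisModule ((p ^ k : ℕ) : ℤ)) v 1 c ∈ H v) ∧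
      addOrderOf x₀ ∣ addOrderOf (galoisCohomology.localization (W.torsionGaloisModule ((p ^ k : ℕ) : ℤ)) w 1 c) ^ 2 := by
  have hprime : p.Prime := Fact.out
  have hpp : IsPrimePow (p ^ k) := ⟨p, k, hprime.prime, hk, rfl⟩
  haveI : Finite (W.geomTorsion ((p ^ k : ℕ) : ℤ)) := finite_geomTorsion_pow W p k
  have hperf := LocalInvariants.canonical_isPerfect (K := K) (n := p ^ k)
  have hsum := Summit.BirchSwinnertonDyer.BirchSwinnertonDyer.Theorems.SchneiderFreeAdditiveX3.PoitouTateReduction.sumLocalTermEqZero_canonical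
    (K := K) (p ^ k)
  have hcompl := Summit.BirchSwinnertonDyer.BirchSwinnertonDyer.Theorems.SchneiderFreeAdditiveX3.PoitouTateReduction.selmerComplement_canonical_holds
    K (p ^ k)
  have hreal : ∀ w' : InfinitePlace K, w'.IsReal →
      Injective (LocalInvariants.canonical K (p ^ k) (Sum.inl w')) := fun w' hw' ↦ by
    rw [LocalInvariants.canonical_inl]
    exact archimedeanInvariantMap_injective_of_isReal hw'
  have hEuler : ∀ v : HeightOneSpectrum (𝓞 K),
      Nat.card (galoisCohomology ((W.torsionGaloisModule ((p ^ k : ℕ) : ℤ)).toLocal (Sum.inr v)) 1) =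
        (Nat.card (nsmulAddMonoidHom (p ^ k) :
            (W.baseChange (v.adicCompletion K)).toAffine.Point →+ _).ker *
          Nat.card (v.adicCompletionIntegers K ⧸
            Ideal.span {((p ^ k : ℕ) : v.adicCompletionIntegers K)})) ^ 2 := fun v ↦ by
    haveI : CharZero (v.adicCompletion K) := charZero_adicCompletion v
    exact natCard_galoisCohomology_one_torsion_adicCompletion_eq_sq W v (p ^ k) hpp
      (localEulerPoincareCharacteristic_holds (v.adicCompletion K))
  exact exists_mem_kummerOutside_addOrderOf_dvd_sq_places W p k e hμ hadd₁ hadd₂ hgal halt hnondeg hperf hsum hcompl hEuler hreal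
    S w hwS H hH x₀

omit [Finite (W.geomTorsion ((p ^ k : ℕ) : ℤ))] in
include halt hnondeg in
/-- **Deep Prop. 2.1, canonical family, `p`-power form** (unconditional, any number field, any places): `ord x₀ = p^M ⟹
ord(loc_w c) = p^j` with `M ≤ 2j`. [cite: McCallumLMS1991, §2 Prop. 2.1 and §5 proof of Prop. 5.2] -/
theorem exists_mem_kummerOutside_addOrderOf_eq_pow_canonical (hk : 0 < k)
    (S : Finset (Place K)) (w : Place K) (hwS : w ∉ S)
    (H : ∀ v : Place K, AddSubgroup (galoisCohomology ((W.torsionGaloisModule ((p ^ k : ℕ) : ℤ)).toLocal v) 1))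
    (hH : ∀ v ∈ S, annLeft (haveI : Finite (W.geomTorsion ((p ^ k : ℕ) : ℤ)) := finite_geomTorsion_pow W p k
      invWeilPairing W (p ^ k) e hμ hadd₁ hadd₂ hgal (LocalInvariants.canonical K (p ^ k)) v) (H v) = H v)
    {x₀ : galoisCohomology ((W.torsionGaloisModule ((p ^ k : ℕ) : ℤ)).toLocal w) 1} {M : ℕ}
    (hx₀ : addOrderOf x₀ = p ^ M) :
    ∃ c ∈ kummerOutside W (p ^ k) (insert w S),
      (∀ v ∈ S, galoisCohomology.localization (W.torsionGaloisModule ((p ^ k : ℕ) : ℤ)) v 1 c ∈ H v) ∧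
      ∃ j : ℕ, addOrderOf (galoisCohomology.localization (W.torsionGaloisModule ((p ^ k : ℕ) : ℤ)) w 1 c) = p ^ j ∧
        M ≤ 2 * j := by
  obtain ⟨c, hc, hcH, hdvd⟩ := exists_mem_kummerOutside_addOrderOf_dvd_sq_canonical W p k e hμ hadd₁ hadd₂ hgal halt hnondeg
    hk S w hwS H hH x₀
  haveI := finite_galoisCohomology_toLocal W (p ^ k) w
  have hr' : addOrderOf (galoisCohomology.localization (W.torsionGaloisModule ((p ^ k : ℕ) : ℤ)) w 1 c) ∣ p ^ k :=
    addOrderOf_dvd_of_nsmul_eq_zero (nsmul_galoisCohomology_toLocal_eq_zero W (p ^ k) _ _)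
  obtain ⟨j, -, hrj⟩ := (Nat.dvd_prime_pow (Fact.out : p.Prime)).mp hr'
  refine ⟨c, hc, hcH, j, hrj, ?_⟩
  rw [hx₀, hrj, ← pow_mul] at hdvd
  have h := (Nat.pow_dvd_pow_iff_le_right (Fact.out : p.Prime).one_lt).mp hdvd
  omega

end Deep

end Summit.BirchSwinnertonDyer.BirchSwinnertonDyer.Theorems.GenusExact.AuxiliaryClass

end
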